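/-
Copyright (c) 2026 the pub-hodgecm-mathlib formalisation cell (harness21).  Prover seat hodgecm-mathlib-LH4-p14 (g5), req620 Track A «(D-RAM) FOUR-FRAME» squad, unit U2H:
the (ρ2b′-X) child `stub_U2H_fixedPointCensus_typeTwo_unit0` (U2H ED. 15 :418) — bottom (A) (type U) of the payer's MAP v3: the (H)-BRANCH KILL letter `hK3` of LH4-p11 (g5)
(2026-09-04T06:57Z), supplied LOCALLY (payer's call «(ii)», 07:08Z) so that SOCKET-hOCA stays v1.  2026-09-04.
-/
import Literature.NumberTheory.LocalFields.ValuedFixedFieldRamifiedOfNe   -- ★ p857938 (LH4-p12 (g5)): `even_order_of_fixed` (residually trivial involution ≠ id ⇒ fixed elements have even order)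
import HarnessLib

/-!
# Crux `H413`, line LH4 «(D-RAM) FOUR-FRAME» — unit U2H, (ρ2b′-X) bottom (A): ON TYPE U EVERY `Θρ`-FIXED ELEMENT HAS EVEN VALUATION
# (the inertia group of the biquadratic `M ∕ F` is `{1, Θρ}`), ELEMENTARY

Cell `hodgecm-mathlib` (D-0151), FLOOR 0, crux item H413 = `stmt-HodgeConjecture-24833`, route of record `HCCMUnconditional`; squad F0∕P3c∕LH4; registered stub served:
`F0P3cDyRamFourFrameU2H.stub_U2H_fixedPointCensus_typeTwo_unit0` ((ρ2b′-X), U2H ED. 15 :418), through the payer's pay line … ∘ ★ `TypeSplit.orderCountCensus2_of_types (hA) …`,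
typed bottom (A) = `SOCKET-hOCA.v1` (LH4-p11 (g5)).  THEOREMS ONLY (no `def`, no instance, no notation, no `sorry`); lane `--supports stmt-HodgeConjecture-24833` (count-neutral).

WHAT IS PROVED.  `M` (the Lean `K`) is a field with a `ℤᵐ⁰`-valuation and FINITE residue field, carrying commuting involutive isometries `ρ` (fixing `E = L_w`) and `Θ`
(`Θ|_E = σ_w`).  TYPE U = (A) in the socket's printed letters: an integral `α` with `|α − ρα| = 1`, the integrality of the `ρ`-coordinates
(`|z| ≤ 1 → |(z − ρz)∕(α − ρα)| ≤ 1`), and `|ρα − Θα| < 1`; the CM-place fact `hσres : ρ z = z → |z| ≤ 1 → |Θz − z| < 1` (`σ_w ≡ id (mod 𝔪_w)` at a ramified `w`,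
transported along `ι_{w₁}` — the 8-line derivation of ★ `TypeSplit`); and a `ρ`-fixed uniformiser `ϖE` moved by `Θ`.  THEN **every non-zero `x` with `Θ(ρ x) = x` has
valuation `exp(2n)`** (`even_v_of_thetaRho_fixed`) — the letter `hK3` that kills the Eisenstein branch of ★ `hSide_closedForm_of_tube_exists` on type (A).
Classically: `M∕E` unramified and `Θ̄ = ρ̄` on `𝓀_M` force the inertia group of `M∕F` to be `{1, Θρ}`, so `Fix(Θρ)∕F` is the unramified quadratic field and
`M∕Fix(Θρ)` is totally ramified.  HERE, inside `M` and WITHOUT residue-extension theory or a third field object (`τ := Θ ∘ ρ`):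
* §1 `sub_lt_one_of_coords` — `τ̄ = id` on `𝒪_M` FROM THE PRINTED LETTERS: `z = e₀ + e₁α` with `ρ`-fixed integral `eᵢ` (`e₁ = (z − ρz)∕(α − ρα)`), `|Θeᵢ − eᵢ| < 1`
  (`hσres`), `|τα − α| = |ρα − Θα| < 1`.
* §2 HEAD `even_v_of_thetaRho_fixed` = ★ `ValuedFixedFieldRamified.even_order_of_fixed` (LH4-p12 (g5): a residually trivial isometric involution `≠ id` with a fixed `P` of
  order 2 has only EVEN-order fixed elements — residue surjectivity of the fixed field by Frobenius, then «a fixed uniformiser forces the identity») applied to `τ`, with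
  `P := ϖE·ΘϖE` (`ρ`- and `Θ`-fixed, `|P| = exp(−2)`) and `τ ϖE = Θ ϖE ≠ ϖE`.
HONEST LABEL.  Count-neutral helper; (ρ2b′-X) OPEN; `HC_CM` is proved only modulo the 7 printed citations (2 remaining named inputs: hLiu418 = `stmt-HodgeConjecture-24832`, h413 =
`stmt-HodgeConjecture-24833`) until rung 0 closes.

## References
* [Serre1979] J.-P. Serre, *Local Fields*, GTM 67 (1979), Ch. I §4 Prop. 10, Ch. I §7 Prop. 20–21 (inertia group, `e·f = n`), Ch. III §6 Prop. 12.
* [Rogawski1990] J. D. Rogawski, *Automorphic Representations of Unitary Groups in Three Variables*, Ann. of Math. Stud. 123 (1990), §4.9 Lemma 4.9.3 p. 56.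
-/

set_option autoImplicit false

noncomputable section

open WithZero

namespace Summit.HodgeConjecture.HodgeConjecture.Cruxes.H413.F0P3cDyRamThetaRhoFixedEven

variable {K : Type*} [Field K] [Valued K ℤᵐ⁰]

/-! ## §1 `τ̄ = id` on `𝒪_M` from the printed type-(A) letters -/

/-- **`τ := Θ∘ρ` acts trivially on `𝒪_M ∕ 𝔪_M`**: for integral `z`, `|Θ(ρz) − z| < 1`.  Coordinates `z = e₀ + e₁α` (`e₁ = (z − ρz)∕(α − ρα)`, `e₀ = z − e₁α`, both
`ρ`-fixed and integral by the socket's integrality letter), `|Θeᵢ − eᵢ| < 1` (`hσres`), `|Θ(ρα) − α| = |ρα − Θα| < 1`. [cite: Serre1979, Ch. III §6 Prop. 12] -/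
theorem sub_lt_one_of_coords {ρ Θ : K →+* K} (hρρ : ∀ x, ρ (ρ x) = x) (hΘΘ : ∀ x, Θ (Θ x) = x)
    (hvρ : ∀ x, Valued.v (ρ x) = Valued.v x) (hvΘ : ∀ x, Valued.v (Θ x) = Valued.v x)
    {α : K} (hα1 : Valued.v α ≤ 1) (hα : Valued.v (α - ρ α) = 1)
    (hint : ∀ z : K, Valued.v z ≤ 1 → Valued.v ((z - ρ z) / (α - ρ α)) ≤ 1) (hτα : Valued.v (ρ α - Θ α) < 1)
    (hσres : ∀ z : K, ρ z = z → Valued.v z ≤ 1 → Valued.v (Θ z - z) < 1)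
    {z : K} (hz : Valued.v z ≤ 1) : Valued.v (Θ (ρ z) - z) < 1 := by
  have hαρ0 : α - ρ α ≠ 0 := fun h => by rw [h, Valuation.map_zero] at hα; exact zero_ne_one hα
  set e₁ : K := (z - ρ z) / (α - ρ α) with he₁
  set e₀ : K := z - e₁ * α with he₀
  have he₁ρ : ρ e₁ = e₁ := by
    rw [he₁, map_div₀, map_sub, map_sub, hρρ, hρρ, ← neg_sub z, ← neg_sub α, neg_div_neg_eq]
  have he₁v : Valued.v e₁ ≤ 1 := hint z hz
  have hz' : z = e₀ + e₁ * α := by rw [he₀]; ring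
  have he₀ρ : ρ e₀ = e₀ := by
    have h : e₀ - ρ e₀ = (z - ρ z) - e₁ * (α - ρ α) := by rw [he₀, map_sub, map_mul, he₁ρ]; ring
    have h0 : (z - ρ z) - e₁ * (α - ρ α) = 0 := by rw [he₁, div_mul_cancel₀ _ hαρ0, sub_self]
    rw [h0, sub_eq_zero] at h; exact h.symm
  have he₀v : Valued.v e₀ ≤ 1 := by
    rw [he₀]
    refine (Valuation.map_sub _ _ _).trans (max_le hz ?_)
    rw [Valuation.map_mul]
    calc Valued.v e₁ * Valued.v α ≤ 1 * 1 := by gcongr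
      _ = 1 := one_mul 1
  have hτα' : Valued.v (Θ (ρ α) - α) < 1 := by
    have h : Θ (ρ α) - α = Θ (ρ α - Θ α) := by rw [map_sub, hΘΘ]
    rw [h, hvΘ]; exact hτα
  have hid : Θ (ρ z) - z = (Θ e₀ - e₀) + (Θ e₁ - e₁) * Θ (ρ α) + e₁ * (Θ (ρ α) - α) := by
    conv_lhs => rw [hz']
    rw [map_add, map_mul, map_add, map_mul, he₀ρ, he₁ρ]; ring
  rw [hid]
  refine (Valuation.map_add _ _ _).trans_lt (max_lt ((Valuation.map_add _ _ _).trans_lt (max_lt (hσres e₀ he₀ρ he₀v) ?_)) ?_)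
  · rw [Valuation.map_mul, hvΘ, hvρ]
    calc Valued.v (Θ e₁ - e₁) * Valued.v α ≤ Valued.v (Θ e₁ - e₁) * 1 := by gcongr
      _ < 1 := by rw [mul_one]; exact hσres e₁ he₁ρ he₁v
  · rw [Valuation.map_mul]
    calc Valued.v e₁ * Valued.v (Θ (ρ α) - α) ≤ 1 * Valued.v (Θ (ρ α) - α) := by gcongr
      _ < 1 := by rw [one_mul]; exact hτα'

/-! ## §2 HEAD: `Θρ`-fixed elements have even valuation on type U -/

/-- **ON TYPE U EVERY NON-ZERO `Θρ`-FIXED ELEMENT OF `M` HAS EVEN VALUATION** (LH4-p11 (g5)'s letter `hK3`, VERBATIM conclusion).  Inputs: the frame (`ρ, Θ` commuting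
involutive isometries), `𝓀_M` finite; the printed type-(A) letters `|α| ≤ 1`, `|z| ≤ 1 → |(z − ρz)∕(α − ρα)| ≤ 1`, `|α − ρα| = 1`, `|ρα − Θα| < 1`; the
CM-place fact `ρ z = z → |z| ≤ 1 → |Θz − z| < 1`; a `ρ`-fixed uniformiser `ϖE` with `ΘϖE ≠ ϖE`.  Proof: ★ `even_order_of_fixed` for `τ := Θ∘ρ` (residually trivial
by §1, `τ ϖE ≠ ϖE`) with `P := ϖE·ΘϖE`. [cite: Serre1979, Ch. I §4 Prop. 10; Ch. I §7 Prop. 20–21; Ch. III §6 Prop. 12] [cite: Rogawski1990, §4.9 Lemma 4.9.3 p. 56] -/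
theorem even_v_of_thetaRho_fixed [Finite (Valued.ResidueField K)]
    {ρ Θ : K →+* K} (hρρ : ∀ x, ρ (ρ x) = x) (hvρ : ∀ x, Valued.v (ρ x) = Valued.v x) (hΘΘ : ∀ x, Θ (Θ x) = x)
    (hΘρ : ∀ x, Θ (ρ x) = ρ (Θ x)) (hvΘ : ∀ x, Valued.v (Θ x) = Valued.v x)
    {α : K} (hα1 : Valued.v α ≤ 1) (hint : ∀ z : K, Valued.v z ≤ 1 → Valued.v ((z - ρ z) / (α - ρ α)) ≤ 1)
    (hα : Valued.v (α - ρ α) = 1) (hτα : Valued.v (ρ α - Θ α) < 1)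
    (hσres : ∀ z : K, ρ z = z → Valued.v z ≤ 1 → Valued.v (Θ z - z) < 1)
    {ϖE : K} (hϖE : Valued.v ϖE = exp (-1 : ℤ)) (hρϖE : ρ ϖE = ϖE) (hΘϖE : Θ ϖE ≠ ϖE) :
    ∀ x : K, Θ (ρ x) = x → x ≠ 0 → ∃ n : ℤ, Valued.v x = exp (2 * n) := by
  intro x hx hx0
  -- `τ := Θ ∘ ρ` is a residually trivial isometric involution moving `ϖE`
  set τ : K →+* K := Θ.comp ρ with hτdef
  have hτ : ∀ z, τ z = Θ (ρ z) := fun z => rfl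
  have hττ : ∀ z, τ (τ z) = z := fun z => by rw [hτ, hτ, hΘρ, hΘΘ, hρρ]
  have hvτ : ∀ z, Valued.v (τ z) = Valued.v z := fun z => by rw [hτ, hvΘ, hvρ]
  have hτres : ∀ z : K, Valued.v z ≤ 1 → Valued.v (z - τ z) < 1 := fun z hz => by
    rw [Valuation.map_sub_swap, hτ]; exact sub_lt_one_of_coords hρρ hΘΘ hvρ hvΘ hα1 hα hint hτα hσres hz
  have hτne : ∃ z, τ z ≠ z := ⟨ϖE, by rw [hτ, hρϖE]; exact hΘϖE⟩
  -- `P := ϖE · ΘϖE` is `τ`-fixed of order 2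
  have hτP : τ (ϖE * Θ ϖE) = ϖE * Θ ϖE := by rw [hτ, map_mul, map_mul, hρϖE, ← hΘρ, hρϖE, hΘΘ, mul_comm]
  have hvP : Valued.v (ϖE * Θ ϖE) = exp (-2 : ℤ) := by rw [Valuation.map_mul, hvΘ, hϖE, ← exp_add]; rfl
  exact Literature.NumberTheory.LocalFields.ValuedFixedFieldRamified.even_order_of_fixed hττ hvτ hτres hτne hτP hvP x hx hx0

end Summit.HodgeConjecture.HodgeConjecture.Cruxes.H413.F0P3cDyRamThetaRhoFixedEven

end
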